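import Summits.CriticalPhenomena.PercolationContinuityZ3.Theorems.PercNearOneGluingNoHeavyLowerTailCoSunflowerGlueRows
import Summits.CriticalPhenomena.PercolationContinuityZ3.Theorems.PercNearOneGluingNoHeavyLowerTailE3GroupSepDecRows
import HarnessLib

/-!
# `NoHeavyLowerTail` (stmt-CriticalPhenomena-4575) — the second open increasing shape `{α, r7, r8}` has ONE generator:
# the four-point row `α` ("hybrid `T_inc`"); with `TIncRow`, `GammaRow` this closes ALL NINE E3GRP rows modulo three named rows

Support file (prover `prim-e3grp-strat-1`, stratified certificates; `--supports stmt-CriticalPhenomena-4575`).  One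
`@[conjecture]` definition (`AlphaRow`, an instance of Kahn's Conjecture 5, OPEN), no sorries, no `native_decide`.

Context (run/shared/lean/prim/prim-e3grp/STRATA.md §2; companion of prim-e3grp-switch-3's `…CoSunflowerGlueRows`, which
reduces the sunflower class `{β, γ, r4, r5, r6}` to the two generators `TIncRow` (three points) and `GammaRow` (four points)
by gluing = weight-one edges).  The remaining open increasing rows `r7 = E₃(U[o|a₁a₂a₃b], U[oa₁|a₂a₃], U[oa₂a₃|a₁])` and
`r8 = r7 ∘ (o ↔ b)` of `…E3GroupSepLeFive`, and the four-point class `α = E₃(U[a|bc], U[ab|c], U[acy|b])` (`Row4Holds 4`),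
are all ONE shape: `T_inc(a, c, b)` with the `b`-petal enlarged by one more terminal ("hybrid `T_inc`", the increasing mirror
of the hybrid three-point lower bound `E₃(D[P|c], D[c|Q], D[P|Q′])`, `Q ⊆ Q′`, proved in `…HybridThreePointLB`).  Exactly:
`r7(o,a₁,a₂,a₃,b)` is `α(a₂, o, a₁, b)` on the graph with `{a₂,a₃}` glued, `r8` likewise with `o ↔ b`.
* `AlphaRow` — the row `α` on every finite weighted graph (named, `@[conjecture]`); `alphaRow_of_kahnConjecture`.
* `row4Holds_four_of_alphaRow` (class `α`), `rowHolds_seven_of_alphaRow`, `rowHolds_eight_of_alphaRow` (every `n`, weight, tuple).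
* `rowHolds_of_generators : TIncRow → GammaRow → AlphaRow → RowHolds i w t` for ALL nine rows `i` (rows 0–3 unconditionally,
  `rowHolds_dec`) — the named hypotheses of the `|A| = 5` assembly can be these three point-level rows instead of "E3GRP".
Certificate status (STRATA.md §4): `T_inc` is not in the cone of the currently proved three-point rows at any degree (exact
strict pseudo-laws, cross-checked by ttrl cp-gz against 10,734 proved rows); these generators are targets for the switching lane.
HONEST FRAMING: typed reduction; `α`, `r7`, `r8` (and E3GRP's increasing half) remain OPEN.
-/

noncomputable section

namespace Summit.CriticalPhenomena.PercolationContinuityZ3.Theorems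

open MeasureTheory Set
open Literature.Probability.LatticeModels
open Literature.Probability.Percolation
open CovTransferCert E3GroupSepCert CoSunflowerGlue

/-- **α — the hybrid `T_inc` row.**  For every finite weighted graph and vertices `a b c y`:
`0 ≤ E₃(U[a|bc], U[ab|c], U[acy|b])` ("`a` joined to `b` or `c`", "`c` joined to `a` or `b`", "`b` joined to `a`, `c` or `y`":
the three-point row `T_inc(a,c,b)` with the `b`-petal enlarged by `y`).  Instance of Kahn's Conjecture 5 / Sahi's `C_3` for
product measures; OPEN (harness class `α`; proved for `n ≤ 5` by kernel certificate, `fourPointClass_le_five`).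
[cite: Kahn2022, Conj. 5 (arXiv p. 3)] [status: open] -/
@[conjecture] def AlphaRow : Prop :=
  ∀ (V : Type) [Fintype V] (w : Sym2 V → unitInterval) (a b c y : V),
    0 ≤ sahiE3 (prodBernoulli w)
      {ω : BondConfig V | ∃ x ∈ ({a} : Set V), ∃ z ∈ ({b, c} : Set V), (openGraph ω).Reachable x z}
      {ω : BondConfig V | ∃ x ∈ ({a, b} : Set V), ∃ z ∈ ({c} : Set V), (openGraph ω).Reachable x z}
      {ω : BondConfig V | ∃ x ∈ ({a, c, y} : Set V), ∃ z ∈ ({b} : Set V), (openGraph ω).Reachable x z}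

/-- **Kahn's Conjecture 5 ⇒ α**. [cite: Kahn2022, Conj. 5 (arXiv p. 3)] -/
theorem alphaRow_of_kahnConjecture (hK : KahnConjecture) : AlphaRow := by
  intro V _ w a b c y
  exact sahiE3_groupConn_nonneg_of_kahnConjecture hK w _ _ _ _ _ _

namespace CoSunflowerGlue

variable {n : ℕ}

/-- `AlphaRow` in the `connEvent (lnk …)` vocabulary. [folklore] -/
theorem alphaRow_connEvent (h : AlphaRow) (w : Sym2 (Fin n) → unitInterval) (a b c y : Fin n) :
    0 ≤ sahiE3 (prodBernoulli w) (connEvent (lnk [a] [b, c])) (connEvent (lnk [a, b] [c]))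
      (connEvent (lnk [a, c, y] [b])) := by
  have key := h (Fin n) w a b c y
  have e1 : {ω : BondConfig (Fin n) | ∃ x ∈ ({a} : Set (Fin n)), ∃ z ∈ ({b, c} : Set (Fin n)),
      (openGraph ω).Reachable x z} = connEvent (lnk [a] [b, c]) := by
    rw [connEvent_lnk]; ext ω; simp only [mem_setOf_eq, mem_insert_iff, mem_singleton_iff, List.mem_cons,
      List.not_mem_nil, or_false]; rfl
  have e2 : {ω : BondConfig (Fin n) | ∃ x ∈ ({a, b} : Set (Fin n)), ∃ z ∈ ({c} : Set (Fin n)),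
      (openGraph ω).Reachable x z} = connEvent (lnk [a, b] [c]) := by
    rw [connEvent_lnk]; ext ω; simp only [mem_setOf_eq, mem_insert_iff, mem_singleton_iff, List.mem_cons,
      List.not_mem_nil, or_false]; rfl
  have e3 : {ω : BondConfig (Fin n) | ∃ x ∈ ({a, c, y} : Set (Fin n)), ∃ z ∈ ({b} : Set (Fin n)),
      (openGraph ω).Reachable x z} = connEvent (lnk [a, c, y] [b]) := by
    rw [connEvent_lnk]; ext ω; simp only [mem_setOf_eq, mem_insert_iff, mem_singleton_iff, List.mem_cons,
      List.not_mem_nil, or_false]; rfl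
  rw [e1, e2, e3] at key
  exact key

/-- **`AlphaRow` ⇒ class `α`** (`Row4Holds 4 = E₃(U[a|bc], U[ab|c], U[acy|b])`) for every `n`, weight and terminals. [folklore] -/
theorem row4Holds_four_of_alphaRow (h : AlphaRow) (w : Sym2 (Fin n) → unitInterval) (a b c y : Fin n) :
    Row4Holds 4 w (a, b, c, y) := by
  have hr : row4 4 (a, b, c, y) = (lnk [a] [b, c], lnk [a, b] [c], lnk [a, c, y] [b]) := rfl
  unfold Row4Holds
  rw [hr, e3Ineq_iff_sahiE3_nonneg]
  exact alphaRow_connEvent h w a b c y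

/-- **`AlphaRow` ⇒ `r7`** (`RowHolds 7 = E₃(U[o|a₁a₂a₃b], U[oa₁|a₂a₃], U[oa₂a₃|a₁])`): `r7` is `α(a₂, o, a₁, b)` on the graph with
`{a₂,a₃}` glued (weight one). [folklore] -/
theorem rowHolds_seven_of_alphaRow (h : AlphaRow) (w : Sym2 (Fin n) → unitInterval) (t : Tup n) :
    RowHolds 7 w t := by
  classical
  obtain ⟨o, a₁, a₂, a₃, b⟩ := t
  have hr : row 7 (o, a₁, a₂, a₃, b) =
      (lnk [o] [a₁, a₂, a₃, b], lnk [o, a₁] [a₂, a₃], lnk [o, a₂, a₃] [a₁]) := rfl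
  unfold RowHolds
  rw [hr, e3Ineq_iff_sahiE3_nonneg]
  have key := alphaRow_connEvent h (Function.update w s(a₂, a₃) 1) a₂ o a₁ b
  rw [sahiE3_update_one, preimage_insert_connEvent_lnk_left [a₂] [o, a₁] a₃ (by simp),
    preimage_insert_connEvent_lnk_left [a₂, o] [a₁] a₃ (by simp),
    preimage_insert_connEvent_lnk_left [a₂, a₁, b] [o] a₃ (by simp)] at key
  -- key : 0 ≤ E₃(U[a₃a₂|oa₁], U[a₃a₂o|a₁], U[a₃a₂a₁b|o]); reorder groups and slots
  rw [connEvent_lnk_swap [a₃, a₂] [o, a₁],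
    connEvent_lnk_congr (X := [o, a₁]) (X' := [o, a₁]) (Y := [a₃, a₂]) (Y' := [a₂, a₃]) (fun _ => Iff.rfl)
      (fun v => by simp only [List.mem_cons, List.not_mem_nil, or_false]; tauto),
    connEvent_lnk_congr (X := [a₃, a₂, o]) (X' := [o, a₂, a₃]) (Y := [a₁]) (Y' := [a₁])
      (fun v => by simp only [List.mem_cons, List.not_mem_nil, or_false]; tauto) (fun _ => Iff.rfl),
    connEvent_lnk_swap [a₃, a₂, a₁, b] [o],
    connEvent_lnk_congr (X := [o]) (X' := [o]) (Y := [a₃, a₂, a₁, b]) (Y' := [a₁, a₂, a₃, b]) (fun _ => Iff.rfl)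
      (fun v => by simp only [List.mem_cons, List.not_mem_nil, or_false]; tauto),
    sahiE3_comm₂₃, sahiE3_comm₁₂] at key
  exact key

/-- **`AlphaRow` ⇒ `r8`** (`RowHolds 8 = E₃(U[a₁|a₂a₃b], U[oa₁a₂a₃|b], U[a₁b|a₂a₃])`, i.e. `r7` under `o ↔ b`): `r8` is
`α(a₂, b, a₁, o)` on the graph with `{a₂,a₃}` glued. [folklore] -/
theorem rowHolds_eight_of_alphaRow (h : AlphaRow) (w : Sym2 (Fin n) → unitInterval) (t : Tup n) :
    RowHolds 8 w t := by
  classical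
  obtain ⟨o, a₁, a₂, a₃, b⟩ := t
  have hr : row 8 (o, a₁, a₂, a₃, b) =
      (lnk [a₁] [a₂, a₃, b], lnk [o, a₁, a₂, a₃] [b], lnk [a₁, b] [a₂, a₃]) := rfl
  unfold RowHolds
  rw [hr, e3Ineq_iff_sahiE3_nonneg]
  have key := alphaRow_connEvent h (Function.update w s(a₂, a₃) 1) a₂ b a₁ o
  rw [sahiE3_update_one, preimage_insert_connEvent_lnk_left [a₂] [b, a₁] a₃ (by simp),
    preimage_insert_connEvent_lnk_left [a₂, b] [a₁] a₃ (by simp),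
    preimage_insert_connEvent_lnk_left [a₂, a₁, o] [b] a₃ (by simp)] at key
  -- key : 0 ≤ E₃(U[a₃a₂|ba₁], U[a₃a₂b|a₁], U[a₃a₂a₁o|b])
  rw [connEvent_lnk_swap [a₃, a₂] [b, a₁],
    connEvent_lnk_congr (X := [b, a₁]) (X' := [a₁, b]) (Y := [a₃, a₂]) (Y' := [a₂, a₃])
      (fun v => by simp only [List.mem_cons, List.not_mem_nil, or_false]; tauto)
      (fun v => by simp only [List.mem_cons, List.not_mem_nil, or_false]; tauto),
    connEvent_lnk_swap [a₃, a₂, b] [a₁],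
    connEvent_lnk_congr (X := [a₁]) (X' := [a₁]) (Y := [a₃, a₂, b]) (Y' := [a₂, a₃, b]) (fun _ => Iff.rfl)
      (fun v => by simp only [List.mem_cons, List.not_mem_nil, or_false]; tauto),
    connEvent_lnk_congr (X := [a₃, a₂, a₁, o]) (X' := [o, a₁, a₂, a₃]) (Y := [b]) (Y' := [b])
      (fun v => by simp only [List.mem_cons, List.not_mem_nil, or_false]; tauto) (fun _ => Iff.rfl),
    sahiE3_comm₁₂, sahiE3_comm₂₃] at key
  exact key

/-! ### All nine E3GRP rows from three point-level rows -/

/-- **All nine E3GRP rows on every finite weighted graph and every terminal tuple, from the three generators `TIncRow`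
(three points), `GammaRow` and `AlphaRow` (four points)** — rows 0–3 unconditionally (`rowHolds_dec`), `r4, r6` from `γ`,
`r5` from `T_inc` (prim-e3grp-switch-3, `…CoSunflowerGlueRows`), `r7, r8` from `α` (this file). [folklore] -/
theorem rowHolds_of_generators (hT : TIncRow) (hG : GammaRow) (hA : AlphaRow) (i : Fin 9)
    (w : Sym2 (Fin n) → unitInterval) (t : Tup n) : RowHolds i w t := by
  fin_cases i
  exacts [rowHolds_dec 0 (by decide) w t, rowHolds_dec 1 (by decide) w t, rowHolds_dec 2 (by decide) w t,
    rowHolds_dec 3 (by decide) w t, rowHolds_four_of_gammaRow hG w t, rowHolds_five_of_tIncRow hT w t,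
    rowHolds_six_of_gammaRow hG w t, rowHolds_seven_of_alphaRow hA w t, rowHolds_eight_of_alphaRow hA w t]

/-- **All seven four-point E3GRP classes `(iii), (ii), (b), F, α, β, γ` on every finite weighted graph and every quadruple, from the
three generators** — classes 0–3 unconditionally (`rowHolds4_zero_all` hybrid 3PT-LB, `rowHolds4_one_all`, `rowHolds4_two_all` group
3PT-LB, `rowHolds4_three_all` = F), `α` from `AlphaRow` (this file), `β` from `TIncRow` and `γ` from `GammaRow` (prim-e3grp-switch-3).
[folklore] -/
theorem row4Holds_of_generators (hT : TIncRow) (hG : GammaRow) (hA : AlphaRow) (i : Fin 7)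
    (w : Sym2 (Fin n) → unitInterval) (a b c y : Fin n) : Row4Holds i w (a, b, c, y) := by
  fin_cases i
  exacts [rowHolds4_zero_all w a b c y, rowHolds4_one_all w a b c y, rowHolds4_two_all w a b c y,
    rowHolds4_three_all w a b c y, row4Holds_four_of_alphaRow hA w a b c y, row4Holds_five_of_tIncRow hT w a b c y,
    row4Holds_six_of_gammaRow hG w a b c y]

end CoSunflowerGlue

end Summit.CriticalPhenomena.PercolationContinuityZ3.Theorems

end
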